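import Mathlib.LinearAlgebra.Matrix.Rank
import Mathlib.Data.Finset.Sort
import Mathlib.Order.Interval.Finset.Fin
import HarnessLib

/-!
# Two tools for the Landsberg–Michałek border-rank bound: rank of a triangular pattern, and ranked elements of a finite set of `Fin q`

Topic `Literature/Computability/AlgebraicComplexity`. Generic lemmas (all [folklore], all PROVED, no
definitions) used by `LandsbergMichalekKoszul.lean` in the proof of Landsberg–Michałek 2018, Thm. 1.1
(`BorderRankMatMulSmall.LandsbergMichalek2018_thm_1_1`):

* `card_filter_le_rank_of_triangular` — if `σ` assigns a column to every row of a matrix `N` and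
  every non-zero entry of the column `σ r` lies in row `r` or in a row of strictly larger `key`
  (a map to a linear order), then the columns `σ r` with `N r (σ r) ≠ 0` are linearly independent;
  hence `#{r | N r (σ r) ≠ 0} ≤ rank N`. This is the form in which Landsberg–Michałek use the
  "upper triangular structure" of the reduced Koszul flattening (LM 2016/2018, §6/§3).
* `card_filter_lt_orderEmbOfFin`, `orderEmbOfFin_eq_of_card_filter_lt`, `orderEmbOfFin_add_le`,
  `le_orderEmbOfFin`, `orderEmbOfFin_le` — the `i`-th smallest element `T.orderEmbOfFin h i` of a
  `k`-subset `T ⊆ Fin q` is characterised by having exactly `i` elements of `T` below it, and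
  satisfies `i ≤ T.orderEmbOfFin h i ≤ q − k + i`.

## References

* J. M. Landsberg, M. Michałek, *On the geometry of border rank algorithms for matrix multiplication
  and other tensors with symmetry*, SIAM J. Appl. Algebra Geom. 1 (2017) = arXiv:1601.08229, §6
  (proof of Thm. 6.1). [LandsbergMichalek2016Symmetry]
* J. M. Landsberg, M. Michałek, *A `2n² − log₂(n) − 1` lower bound for the border rank of matrix
  multiplication*, IMRN 2018 (15) 4722–4733 = arXiv:1608.07486, §3. [LandsbergMichalek2018]
-/

open scoped BigOperators

namespace Literature.Computability.AlgebraicComplexity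

/-! ## Rank of a triangular pattern -/

section TriangularRank

variable {K : Type*} [Field K] [DecidableEq K] {R C L : Type*} [Fintype R] [Fintype C] [LinearOrder L]

/-- **Rank of a triangular pattern.** Let `N` be a matrix, `σ` a choice of a column for every row
and `key` a map from rows to a linear order such that every non-zero entry of the column `σ r` lies
in row `r` itself or in a row of strictly larger key. Then the columns `σ r` with `N r (σ r) ≠ 0`
are linearly independent (look at the row of smallest key in the support of a relation), so their
number bounds the rank from below. [folklore] -/
theorem card_filter_le_rank_of_triangular (N : Matrix R C K) (σ : R → C) (key : R → L)
    (hN : ∀ r r', N r' (σ r) ≠ 0 → r' = r ∨ key r < key r') :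
    (Finset.univ.filter fun r => N r (σ r) ≠ 0).card ≤ N.rank := by
  classical
  set D := Finset.univ.filter fun r => N r (σ r) ≠ 0 with hD
  have hli : LinearIndependent K (fun r : D => N.col (σ r)) := by
    rw [Fintype.linearIndependent_iff]
    intro g hg
    by_contra hne
    push Not at hne
    obtain ⟨r₀, hr₀, hmin⟩ := Finset.exists_min_image (Finset.univ.filter fun r : D => g r ≠ 0)
      (fun r => key r) (by obtain ⟨r, hr⟩ := hne; exact ⟨r, by simp [hr]⟩)
    have hg0 : g r₀ ≠ 0 := by simpa using hr₀
    have hrow := congr_fun hg (r₀ : R)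
    simp only [Finset.sum_apply, Pi.smul_apply, Matrix.col_apply, smul_eq_mul,
      Pi.zero_apply] at hrow
    rw [Finset.sum_eq_single r₀] at hrow
    · have hD0 : N (r₀ : R) (σ r₀) ≠ 0 := by
        have := r₀.2
        simp only [hD, Finset.mem_filter] at this
        exact this.2
      exact hg0 ((mul_eq_zero.1 hrow).resolve_right hD0)
    · intro r _ hr
      by_cases hgr : g r = 0
      · rw [hgr, zero_mul]
      · have h0 : N (r₀ : R) (σ r) = 0 := by
          by_contra hN0
          rcases hN r r₀ hN0 with h | h
          · exact hr (Subtype.ext h).symm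
          · exact absurd (hmin r (by simp [hgr])) (not_le.2 h)
        rw [h0, mul_zero]
    · intro h; exact absurd (Finset.mem_univ _) h
  have h3 : Fintype.card D ≤ N.rank := by
    rw [Matrix.rank_eq_finrank_span_cols]
    have hli' : LinearIndependent K (fun r : D => (⟨N.col (σ r), Submodule.subset_span ⟨_, rfl⟩⟩ :
        Submodule.span K (Set.range N.col))) :=
      LinearIndependent.of_comp (Submodule.span K (Set.range N.col)).subtype hli
    exact hli'.fintype_card_le_finrank
  simpa using h3

end TriangularRank

/-! ## The `i`-th smallest element of a subset of `Fin q` -/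

section OrderEmb

variable {q : ℕ}

/-- The elements of `T` below its `i`-th smallest element are `i` in number. [folklore] -/
theorem card_filter_lt_orderEmbOfFin (T : Finset (Fin q)) {k : ℕ} (h : T.card = k) (i : Fin k) :
    (T.filter (· < T.orderEmbOfFin h i)).card = i := by
  classical
  have : T.filter (· < T.orderEmbOfFin h i) =
      (Finset.Iio i).map (T.orderEmbOfFin h).toEmbedding := by
    ext x
    simp only [Finset.mem_filter, Finset.mem_map, Finset.mem_Iio, RelEmbedding.coe_toEmbedding]
    constructor
    · rintro ⟨hx, hlt⟩
      obtain ⟨j, rfl⟩ : x ∈ Set.range (T.orderEmbOfFin h) := by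
        rw [Finset.range_orderEmbOfFin]; exact hx
      exact ⟨j, (T.orderEmbOfFin h).lt_iff_lt.1 hlt, rfl⟩
    · rintro ⟨j, hj, rfl⟩
      exact ⟨Finset.orderEmbOfFin_mem _ _ _, (T.orderEmbOfFin h).lt_iff_lt.2 hj⟩
  rw [this, Finset.card_map, Fin.card_Iio]

/-- Characterisation of the `i`-th smallest element of `T` as the element of `T` with exactly `i`
elements of `T` below it. [folklore] -/
theorem orderEmbOfFin_eq_of_card_filter_lt (T : Finset (Fin q)) {k : ℕ} (h : T.card = k) (i : Fin k)
    {x : Fin q} (hx : x ∈ T) (hcard : (T.filter (· < x)).card = i) : T.orderEmbOfFin h i = x := by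
  classical
  obtain ⟨j, rfl⟩ : x ∈ Set.range (T.orderEmbOfFin h) := by
    rw [Finset.range_orderEmbOfFin]; exact hx
  rw [card_filter_lt_orderEmbOfFin] at hcard
  rw [Fin.ext_iff.2 hcard.symm]

/-- Smallest elements of ranks `i ≤ j` differ by at least `j − i` (a strictly increasing sequence of
naturals). [folklore] -/
theorem orderEmbOfFin_add_le (T : Finset (Fin q)) {k : ℕ} (h : T.card = k) {i j : Fin k}
    (hij : i ≤ j) : (T.orderEmbOfFin h i : ℕ) + (j - i) ≤ T.orderEmbOfFin h j := by
  obtain ⟨d, hd⟩ : ∃ d : ℕ, (j : ℕ) = i + d := ⟨j - i, by omega⟩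
  have key : ∀ d : ℕ, ∀ j : Fin k, (j : ℕ) = i + d →
      (T.orderEmbOfFin h i : ℕ) + d ≤ T.orderEmbOfFin h j := by
    intro d
    induction d with
    | zero =>
      intro j hj
      have : j = i := Fin.ext (by omega)
      subst this; simp
    | succ d ih =>
      intro j hj
      have hj1 : (⟨i + d, by omega⟩ : Fin k) < j := Fin.lt_def.2 (by simp; omega)
      have h1 := ih ⟨i + d, by omega⟩ rfl
      have h2 : T.orderEmbOfFin h ⟨i + d, by omega⟩ < T.orderEmbOfFin h j :=
        (T.orderEmbOfFin h).lt_iff_lt.2 hj1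
      have h2' := Fin.lt_def.1 h2
      omega
  have := key d j hd
  rwa [show (j : ℕ) - i = d by omega]

/-- The `i`-th smallest element of a subset of `Fin q` is at least `i`. [folklore] -/
theorem le_orderEmbOfFin (T : Finset (Fin q)) {k : ℕ} (h : T.card = k) (i : Fin k) :
    (i : ℕ) ≤ T.orderEmbOfFin h i := by
  have hk : 0 < k := lt_of_le_of_lt (Nat.zero_le _) i.2
  have := orderEmbOfFin_add_le T h (i := ⟨0, hk⟩) (j := i) (Fin.mk_le_mk.2 (Nat.zero_le _))
  simp only [Nat.sub_zero] at this
  omega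

/-- The `i`-th smallest element of a `k`-subset of `Fin q` is at most `q − k + i` (written
additively). [folklore] -/
theorem orderEmbOfFin_le (T : Finset (Fin q)) {k : ℕ} (h : T.card = k) (i : Fin k) :
    (T.orderEmbOfFin h i : ℕ) + k ≤ q + i := by
  have hk : 0 < k := lt_of_le_of_lt (Nat.zero_le _) i.2
  have h1 := orderEmbOfFin_add_le T h (i := i) (j := ⟨k - 1, by omega⟩)
    (Fin.mk_le_mk.2 (by have := i.2; omega))
  have h2 := (T.orderEmbOfFin h ⟨k - 1, by omega⟩).2
  simp only at h1
  omega

end OrderEmb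

end Literature.Computability.AlgebraicComplexity
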